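import Mathlib
import Literature.Analysis.Convex.ConeGeneration
import HarnessLib

/-!
# `LogPrimitiveNL` (stmt-KontsevichZagierPeriods-2836, route LiouvilleUnfolding) — line
`logderiv-peeling`, stub `stub_coneDecomposition`: auxiliary file (generation of the cone)

Pure finite-dimensional linear algebra behind the registered stub `stub_coneDecomposition`
(proved in `…StubConeDecomposition.lean`). For an integer matrix `F : Fin R → Fin k → ℤ` let
`P = {ℓ ∈ ℝᵏ | ℓ ≥ 0, ∀ r, f_r · ℓ = 0}` be the nonnegative part of its real kernel. This file
proves:

* `cone_exists_int_of_ker` — a nonzero REAL kernel vector `c` dominates, in support, a nonzero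
  INTEGER kernel vector (apply a `ℚ`-linear retraction `φ : ℝ → ℚ` with `φ (c i₀) = 1`
  coordinatewise — integer coefficients pass through `φ` — and clear denominators);
* `cone_exists_gen` — a finite stock of generators `G S ∈ ℕᵏ` (`S ⊆ Fin k`): integer kernel vectors
  supported in `S`, nonzero as soon as `S` supports a nonzero one (a choice, packaged as an
  existence statement so that no new definition is introduced);
* `cone_generation_induction`, `cone_exists_rep` — every `ℓ ∈ P` is a nonnegative real
  combination of the `G S` (support induction as in `Literature.Analysis.Convex.cone_induction`:
  move along `±` an integer kernel direction dominated by `ℓ` until a coordinate dies; when the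
  direction is one-signed the support of `ℓ` carries a generator and one moves along that
  generator instead);
* `cone_generation` — the two previous items packaged (the registered auxiliary statement);
* `cone_exists_indep_rep` — conic Carathéodory: a nonnegative combination may be re-chosen with
  the vectors carrying nonzero coefficients linearly independent (fewest nonzero coefficients).

No analysis, no named facts. [folklore]
-/

noncomputable section

open Finset

namespace Summit.KontsevichZagierPeriods.LiouvilleUnfolding.LogPrimitiveNL

variable {k R : ℕ}

/-- The real kernel equations `∑ᵢ F r i · cᵢ = 0` are preserved by `c ↦ c - t • d`. -/
theorem cone_ker_sub_smul {F : Fin R → Fin k → ℤ} {c d : Fin k → ℝ}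
    (hc : ∀ r, ∑ i, (F r i : ℝ) * c i = 0) (hd : ∀ r, ∑ i, (F r i : ℝ) * d i = 0) (t : ℝ) :
    ∀ r, ∑ i, (F r i : ℝ) * (c - t • d) i = 0 := by
  intro r
  have : ∑ i, (F r i : ℝ) * (c - t • d) i =
      ∑ i, (F r i : ℝ) * c i - t * ∑ i, (F r i : ℝ) * d i := by
    simp only [Pi.sub_apply, Pi.smul_apply, smul_eq_mul, mul_sub, Finset.sum_sub_distrib,
      Finset.mul_sum]
    congr 1
    exact Finset.sum_congr rfl fun i _ => by ring
  rw [this, hc r, hd r, mul_zero, sub_zero]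

/-- The real kernel equations are preserved by `d ↦ -d`. -/
theorem cone_ker_neg {F : Fin R → Fin k → ℤ} {d : Fin k → ℝ}
    (hd : ∀ r, ∑ i, (F r i : ℝ) * d i = 0) : ∀ r, ∑ i, (F r i : ℝ) * (-d) i = 0 := by
  intro r
  simp only [Pi.neg_apply, mul_neg, Finset.sum_neg_distrib, hd r, neg_zero]

/-- Clearing denominators: a finite family of rationals is `1/D` times a family of integers for
some positive natural number `D` (the product of the denominators). -/
theorem cone_exists_int_eq_nat_mul {ι : Type*} [Fintype ι] (v : ι → ℚ) :
    ∃ D : ℕ, 0 < D ∧ ∃ w : ι → ℤ, ∀ i, (w i : ℚ) = (D : ℚ) * v i := by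
  obtain ⟨D, hD, hdvd⟩ : ∃ D : ℕ, 0 < D ∧ ∀ i, (v i).den ∣ D :=
    ⟨∏ i, (v i).den, Finset.prod_pos fun i _ => (v i).den_pos,
      fun i => Finset.dvd_prod_of_mem (fun j => (v j).den) (Finset.mem_univ i)⟩
  refine ⟨D, hD, fun i => ((D / (v i).den : ℕ) : ℤ) * (v i).num, fun i => ?_⟩
  obtain ⟨m, hm⟩ := hdvd i
  dsimp only
  rw [hm, Nat.mul_div_cancel_left m (v i).den_pos]
  push_cast
  rw [← Rat.mul_den_eq_num (v i)]
  ring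

/-- A nonzero real vector in the kernel of an integer matrix dominates, in support, a nonzero
integer kernel vector: choose `i₀` with `c i₀ ≠ 0` and a `ℚ`-linear retraction `φ : ℝ → ℚ` of
`q ↦ q • c i₀` (so `φ (c i₀) = 1`); since the coefficients `F r i` are integers,
`(φ (c i))ᵢ` is a rational kernel vector, vanishing where `c` does; clear denominators. -/
theorem cone_exists_int_of_ker (F : Fin R → Fin k → ℤ) {c : Fin k → ℝ}
    (hc : ∀ r, ∑ i, (F r i : ℝ) * c i = 0) (hc0 : c ≠ 0) :
    ∃ h : Fin k → ℤ, h ≠ 0 ∧ (∀ r, ∑ i, F r i * h i = 0) ∧ ∀ i, c i = 0 → h i = 0 := by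
  obtain ⟨i₀, hi₀⟩ : ∃ i₀, c i₀ ≠ 0 := Function.ne_iff.mp hc0
  obtain ⟨φ, hφ⟩ := (LinearMap.toSpanSingleton ℚ ℝ (c i₀)).exists_leftInverse_of_injective
    (LinearMap.ker_toSpanSingleton ℚ hi₀)
  have hφ1 : φ (c i₀) = 1 := by
    have := LinearMap.congr_fun hφ (1 : ℚ)
    simpa using this
  have hv : ∀ r, ∑ i, (F r i : ℚ) * φ (c i) = 0 := by
    intro r
    have h1 : ∑ i, (F r i : ℤ) • c i = 0 := by
      simpa only [zsmul_eq_mul] using hc r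
    have h2 : φ (∑ i, (F r i : ℤ) • c i) = ∑ i, (F r i : ℚ) * φ (c i) := by
      rw [map_sum]
      refine Finset.sum_congr rfl fun i _ => ?_
      rw [map_zsmul, zsmul_eq_mul]
    rw [← h2, h1, map_zero]
  obtain ⟨D, hD, w, hw⟩ := cone_exists_int_eq_nat_mul fun i => φ (c i)
  refine ⟨w, fun hw0 => ?_, fun r => ?_, fun i hi => ?_⟩
  · have := hw i₀
    rw [hw0, Pi.zero_apply, Int.cast_zero, hφ1, mul_one] at this
    exact (Nat.cast_ne_zero.mpr hD.ne') this.symm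
  · have : ((∑ i, F r i * w i : ℤ) : ℚ) = D * ∑ i, (F r i : ℚ) * φ (c i) := by
      push_cast
      simp only [hw, Finset.mul_sum]
      exact Finset.sum_congr rfl fun i _ => by ring
    rw [hv r, mul_zero] at this
    exact_mod_cast this
  · have := hw i
    rw [hi, map_zero, mul_zero] at this
    exact_mod_cast this

/-- **The stock of generators.** There is a family `G S ∈ ℕᵏ` (`S ⊆ Fin k`) of integer kernel
vectors of `F`, `G S` supported inside `S`, with `G S ≠ 0` as soon as `S` supports some nonzero
nonnegative integer kernel vector (choose one; `0` otherwise). -/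
theorem cone_exists_gen (F : Fin R → Fin k → ℤ) :
    ∃ G : Finset (Fin k) → Fin k → ℕ, (∀ S r, ∑ i, F r i * (G S i : ℤ) = 0) ∧
      (∀ S i, i ∉ S → G S i = 0) ∧
      ∀ S, (∃ g : Fin k → ℕ, g ≠ 0 ∧ (∀ r, ∑ i, F r i * (g i : ℤ) = 0) ∧ ∀ i, i ∉ S → g i = 0) →
        G S ≠ 0 := by
  classical
  let P : Finset (Fin k) → (Fin k → ℕ) → Prop := fun S g =>
    g ≠ 0 ∧ (∀ r, ∑ i, F r i * (g i : ℤ) = 0) ∧ ∀ i, i ∉ S → g i = 0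
  have hP : ∀ S, (h : ∃ g, P S g) → P S h.choose := fun S h => h.choose_spec
  refine ⟨fun S => if h : ∃ g, P S g then h.choose else 0, fun S r => ?_, fun S i hi => ?_,
    fun S h => ?_⟩
  · by_cases h : ∃ g, P S g
    · simp only [dif_pos h]
      exact (hP S h).2.1 r
    · simp [dif_neg h]
  · by_cases h : ∃ g, P S g
    · simp only [dif_pos h]
      exact (hP S h).2.2 i hi
    · simp [dif_neg h]
  · have h' : ∃ g, P S g := h
    simp only [dif_pos h']
    exact (hP S h').1

/-- **Generation of the kernel cone by the integer generators**, as an induction principle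
(compare `Literature.Analysis.Convex.cone_induction`): a property of vectors of `ℝᵏ` holding at
`0` and at every generator `G S`, stable under sums and positive scalings, holds on the whole cone
`P = {c ≥ 0, ∀ r, f_r · c = 0}`. Proof by induction on the support of `c ∈ P`, `c ≠ 0`: an
integer kernel vector `e ≠ 0` dominated by `c` exists (`cone_exists_int_of_ker`); if `e` has entries
of both signs, moving along `e` and along `-e` until a coordinate dies writes `c` as a positive
combination of two cone vectors of smaller support; otherwise `±e ≥ 0` shows that the support `S`
of `c` carries a generator, and `c = (c - t • G S) + t • G S` with the first term of smaller
support. -/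
theorem cone_generation_induction (F : Fin R → Fin k → ℤ) (G : Finset (Fin k) → Fin k → ℕ)
    (hGker : ∀ S r, ∑ i, F r i * (G S i : ℤ) = 0) (hGsupp : ∀ S i, i ∉ S → G S i = 0)
    (hGne : ∀ S, (∃ g : Fin k → ℕ, g ≠ 0 ∧ (∀ r, ∑ i, F r i * (g i : ℤ) = 0) ∧
      ∀ i, i ∉ S → g i = 0) → G S ≠ 0)
    (Q : (Fin k → ℝ) → Prop) (h0 : Q 0) (hgen : ∀ S : Finset (Fin k), Q (fun i => (G S i : ℝ)))
    (hadd : ∀ c c' : Fin k → ℝ, Q c → Q c' → Q (c + c'))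
    (hsmul : ∀ (t : ℝ) (c : Fin k → ℝ), 0 < t → Q c → Q (t • c)) :
    ∀ c : Fin k → ℝ, (∀ j, 0 ≤ c j) → (∀ r, ∑ i, (F r i : ℝ) * c i = 0) → Q c := by
  classical
  suffices H : ∀ n, ∀ c : Fin k → ℝ, (univ.filter fun j => c j ≠ 0).card = n →
      (∀ j, 0 ≤ c j) → (∀ r, ∑ i, (F r i : ℝ) * c i = 0) → Q c from
    fun c hc hK => H _ c rfl hc hK
  intro n
  induction n using Nat.strong_induction_on with
  | _ n ih =>
  intro c hcard hc hK
  by_cases hc0 : c = 0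
  · rw [hc0]; exact h0
  -- the generic step, for a kernel direction `d` dominated by `c` with a positive entry
  have step : ∀ d : Fin k → ℝ, (∀ r, ∑ i, (F r i : ℝ) * d i = 0) → (∀ j, d j ≠ 0 → c j ≠ 0) →
      (∃ j, 0 < d j) → ∃ t : ℝ, 0 < t ∧ (∀ j, 0 ≤ (c - t • d) j) ∧
        (∀ r, ∑ i, (F r i : ℝ) * (c - t • d) i = 0) ∧ Q (c - t • d) := by
    intro d hdK hdc hpos
    obtain ⟨t, ht, hnn, j₀, hj₀, hzero⟩ :=
      Literature.Analysis.Convex.exists_sub_smul_nonneg c d hc hdc hpos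
    have hnn' : ∀ j, 0 ≤ (c - t • d) j := fun j => by simpa using hnn j
    have hK' : ∀ r, ∑ i, (F r i : ℝ) * (c - t • d) i = 0 := cone_ker_sub_smul hK hdK t
    refine ⟨t, ht, hnn', hK', ih _ ?_ _ rfl hnn' hK'⟩
    rw [← hcard]
    refine Finset.card_lt_card ⟨fun j hj => ?_, ?_⟩
    · rw [Finset.mem_filter] at hj ⊢
      refine ⟨Finset.mem_univ _, fun hcj => hj.2 ?_⟩
      have hdj : d j = 0 := by
        by_contra h
        exact hdc j h hcj
      simp [hcj, hdj]
    · rw [Finset.not_subset]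
      refine ⟨j₀, Finset.mem_filter.2 ⟨Finset.mem_univ _, hdc j₀ hj₀⟩, fun h => ?_⟩
      rw [Finset.mem_filter] at h
      exact h.2 (by simpa using hzero)
  -- an integer kernel vector dominated by `c`, with a positive entry
  obtain ⟨h, hh0, hhK, hhc⟩ := cone_exists_int_of_ker F hK hc0
  obtain ⟨e, heK, hec, hpos⟩ : ∃ e : Fin k → ℤ, (∀ r, ∑ i, F r i * e i = 0) ∧
      (∀ i, c i = 0 → e i = 0) ∧ ∃ j, 0 < e j := by
    by_cases hp : ∃ j, 0 < h j
    · exact ⟨h, hhK, hhc, hp⟩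
    · push Not at hp
      obtain ⟨j, hj⟩ := Function.ne_iff.mp hh0
      refine ⟨-h, fun r => ?_, fun i hi => by simp [hhc i hi], j, ?_⟩
      · simp only [Pi.neg_apply, mul_neg, Finset.sum_neg_distrib, hhK r, neg_zero]
      · simp only [Pi.neg_apply, Left.neg_pos_iff]
        exact lt_of_le_of_ne (hp j) hj
  by_cases hneg : ∃ j, e j < 0
  · -- entries of both signs: move along `e` and along `-e`
    let d : Fin k → ℝ := fun i => (e i : ℝ)
    have hdK : ∀ r, ∑ i, (F r i : ℝ) * d i = 0 := fun r => by
      have := congrArg (Int.cast : ℤ → ℝ) (heK r)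
      push_cast at this
      exact this
    have hdc : ∀ j, d j ≠ 0 → c j ≠ 0 := fun j hj hcj => hj (by simp [d, hec j hcj])
    obtain ⟨j₁, hj₁⟩ := hpos
    obtain ⟨t, ht, -, -, hQt⟩ :=
      step d hdK hdc ⟨j₁, show (0 : ℝ) < (e j₁ : ℝ) by exact_mod_cast hj₁⟩
    obtain ⟨j, hj⟩ := hneg
    obtain ⟨s, hs, -, -, hQs⟩ := step (-d) (cone_ker_neg hdK)
      (fun j' hj' => hdc j' (by simpa using hj')) ⟨j, by
        simp only [Pi.neg_apply, Left.neg_pos_iff, d]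
        exact_mod_cast hj⟩
    have hts : 0 < t + s := add_pos ht hs
    have key : c = (s / (t + s)) • (c - t • d) + (t / (t + s)) • (c - s • (-d)) := by
      ext j
      simp only [Pi.add_apply, Pi.smul_apply, Pi.sub_apply, Pi.neg_apply, smul_eq_mul]
      field_simp
      ring
    rw [key]
    exact hadd _ _ (hsmul _ _ (div_pos hs hts) hQt) (hsmul _ _ (div_pos ht hts) hQs)
  · -- `e ≥ 0`: the support of `c` carries a generator; move along it
    push Not at hneg
    set S : Finset (Fin k) := univ.filter fun j => c j ≠ 0 with hS
    have hex : ∃ g : Fin k → ℕ, g ≠ 0 ∧ (∀ r, ∑ i, F r i * (g i : ℤ) = 0) ∧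
        ∀ i, i ∉ S → g i = 0 := by
      refine ⟨fun i => (e i).toNat, ?_, fun r => ?_, fun i hi => ?_⟩
      · obtain ⟨j, hj⟩ := hpos
        intro h0
        have := congrFun h0 j
        simp only [Pi.zero_apply, Int.toNat_eq_zero] at this
        omega
      · have : ∀ i, ((e i).toNat : ℤ) = e i := fun i => Int.toNat_of_nonneg (hneg i)
        simp only [this]
        exact heK r
      · have hci : c i = 0 := by simpa [hS] using hi
        simp [hec i hci]
    have hG : G S ≠ 0 := hGne S hex
    let d : Fin k → ℝ := fun i => (G S i : ℝ)
    have hdK : ∀ r, ∑ i, (F r i : ℝ) * d i = 0 := fun r => by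
      have := congrArg (Int.cast : ℤ → ℝ) (hGker S r)
      push_cast at this
      exact this
    have hdc : ∀ j, d j ≠ 0 → c j ≠ 0 := by
      intro j hj
      have hjS : j ∈ S := by
        by_contra hjS
        exact hj (by simp [d, hGsupp S j hjS])
      exact (mem_filter.1 hjS).2
    have hdpos : ∃ j, 0 < d j := by
      obtain ⟨j, hj⟩ := Function.ne_iff.mp hG
      exact ⟨j, Nat.cast_pos.mpr (Nat.pos_of_ne_zero hj)⟩
    obtain ⟨t, ht, -, -, hQt⟩ := step d hdK hdc hdpos
    have key : c = (c - t • d) + t • d := by simp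
    rw [key]
    exact hadd _ _ hQt (hsmul t d ht (hgen S))

/-- Every nonnegative real kernel vector is a nonnegative real combination of the generators
`G S`, `S ⊆ Fin k` (for a stock of generators as provided by `cone_exists_gen`). -/
theorem cone_exists_rep (F : Fin R → Fin k → ℤ) (G : Finset (Fin k) → Fin k → ℕ)
    (hGker : ∀ S r, ∑ i, F r i * (G S i : ℤ) = 0) (hGsupp : ∀ S i, i ∉ S → G S i = 0)
    (hGne : ∀ S, (∃ g : Fin k → ℕ, g ≠ 0 ∧ (∀ r, ∑ i, F r i * (g i : ℤ) = 0) ∧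
      ∀ i, i ∉ S → g i = 0) → G S ≠ 0)
    (c : Fin k → ℝ) (hc : ∀ j, 0 ≤ c j) (hK : ∀ r, ∑ i, (F r i : ℝ) * c i = 0) :
    ∃ coef : Finset (Fin k) → ℝ, (∀ S, 0 ≤ coef S) ∧
      ∀ i, c i = ∑ S, coef S * (G S i : ℝ) := by
  classical
  refine cone_generation_induction F G hGker hGsupp hGne (fun c => ∃ coef : Finset (Fin k) → ℝ,
      (∀ S, 0 ≤ coef S) ∧ ∀ i, c i = ∑ S, coef S * (G S i : ℝ))
    ⟨0, fun _ => le_rfl, fun i => by simp⟩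
    (fun S₀ => ⟨fun S => if S = S₀ then 1 else 0, fun S => by dsimp only; split_ifs <;> norm_num,
      fun i => by simp [ite_mul]⟩) ?_ ?_ c hc hK
  · rintro c c' ⟨e, he, hce⟩ ⟨e', he', hce'⟩
    exact ⟨e + e', fun S => add_nonneg (he S) (he' S), fun i => by
      simp only [Pi.add_apply, add_mul, Finset.sum_add_distrib, ← hce i, ← hce' i]⟩
  · rintro t c ht ⟨e, he, hce⟩
    exact ⟨fun S => t * e S, fun S => mul_nonneg ht.le (he S), fun i => by
      simp only [Pi.smul_apply, smul_eq_mul, hce i, Finset.mul_sum, mul_assoc]⟩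

/-- **Conic Carathéodory.** A nonnegative combination `c = ∑ⱼ coefⱼ vⱼ` of finitely many real
vectors can be re-chosen so that the vectors carrying a nonzero coefficient are linearly
independent: a representation with the fewest nonzero coefficients has this property (a
dependence `∑ μⱼ vⱼ = 0` supported there, normalised to have a positive entry, could be
subtracted until a coefficient dies, `Literature.Analysis.Convex.exists_sub_smul_nonneg`). The
independence is stated concretely: every real dependence supported on `{j | coef'ⱼ ≠ 0}` is
trivial. -/
theorem cone_exists_indep_rep {ι : Type*} [Fintype ι] {n : ℕ} (v : ι → Fin n → ℝ) (c : Fin n → ℝ)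
    (coef : ι → ℝ) (h0 : ∀ j, 0 ≤ coef j) (hc : ∀ i, c i = ∑ j, coef j * v j i) :
    ∃ coef' : ι → ℝ, (∀ j, 0 ≤ coef' j) ∧ (∀ i, c i = ∑ j, coef' j * v j i) ∧
      ∀ μ : ι → ℝ, (∀ j, coef' j = 0 → μ j = 0) → (∀ i, ∑ j, μ j * v j i = 0) →
        ∀ j, μ j = 0 := by
  classical
  let P : ℕ → Prop := fun m => ∃ e : ι → ℝ, (∀ j, 0 ≤ e j) ∧ (∀ i, c i = ∑ j, e j * v j i) ∧
    (univ.filter fun j => e j ≠ 0).card = m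
  have hP : ∃ m, P m := ⟨_, coef, h0, hc, rfl⟩
  obtain ⟨e, he0, hec, hcard⟩ := Nat.find_spec hP
  refine ⟨e, he0, hec, fun μ hμ hμv => ?_⟩
  by_contra hne
  push Not at hne
  -- normalise the dependence to have a positive entry
  obtain ⟨ν, hν, hνv, hνpos⟩ : ∃ ν : ι → ℝ, (∀ j, e j = 0 → ν j = 0) ∧
      (∀ i, ∑ j, ν j * v j i = 0) ∧ ∃ j, 0 < ν j := by
    by_cases hp : ∃ j, 0 < μ j
    · exact ⟨μ, hμ, hμv, hp⟩
    · push Not at hp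
      obtain ⟨j, hj⟩ := hne
      refine ⟨-μ, fun j' hj' => by simp [hμ j' hj'], fun i => ?_, j, ?_⟩
      · simp only [Pi.neg_apply, neg_mul, Finset.sum_neg_distrib, hμv i, neg_zero]
      · simp only [Pi.neg_apply, Left.neg_pos_iff]
        exact lt_of_le_of_ne (hp j) hj
  have hνe : ∀ j, ν j ≠ 0 → e j ≠ 0 := fun j hj hej => hj (hν j hej)
  obtain ⟨t, -, hnn, j₀, hj₀, hzero⟩ :=
    Literature.Analysis.Convex.exists_sub_smul_nonneg e ν he0 hνe hνpos
  -- the cheaper representation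
  have hP' : P ((univ.filter fun j => e j - t * ν j ≠ 0).card) := by
    refine ⟨fun j => e j - t * ν j, hnn, fun i => ?_, rfl⟩
    have : ∑ j, t * ν j * v j i = t * ∑ j, ν j * v j i := by
      rw [Finset.mul_sum]
      exact Finset.sum_congr rfl fun j _ => by ring
    simp only [sub_mul, Finset.sum_sub_distrib, this, hνv i, mul_zero, sub_zero]
    exact hec i
  have hlt : (univ.filter fun j => e j - t * ν j ≠ 0).card <
      (univ.filter fun j => e j ≠ 0).card := by
    refine Finset.card_lt_card ⟨fun j hj => ?_, ?_⟩
    · rw [Finset.mem_filter] at hj ⊢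
      refine ⟨mem_univ _, fun hej => hj.2 ?_⟩
      rw [hej, hν j hej, mul_zero, sub_zero]
    · rw [Finset.not_subset]
      exact ⟨j₀, mem_filter.2 ⟨mem_univ _, hνe j₀ hj₀⟩, fun h => (mem_filter.1 h).2 hzero⟩
  have hmin := Nat.find_min' hP hP'
  rw [hcard] at hlt
  omega

/-- **Generation of the rational kernel cone by finitely many integer vectors** (the main export
of this file, registered as an auxiliary stub of the crux): for an integer matrix `F` there is a
finite stock `G S ∈ ℕᵏ` (`S ⊆ Fin k`) of integer kernel vectors such that every nonnegative real
kernel vector is a nonnegative real combination of them (`cone_exists_gen` + `cone_exists_rep`).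
[folklore] -/
theorem cone_generation : ∀ (k R : ℕ) (F : Fin R → Fin k → ℤ),
    ∃ G : Finset (Fin k) → Fin k → ℕ, (∀ S r, ∑ i, F r i * (G S i : ℤ) = 0) ∧
      ∀ c : Fin k → ℝ, (∀ j, 0 ≤ c j) → (∀ r, ∑ i, (F r i : ℝ) * c i = 0) →
        ∃ coef : Finset (Fin k) → ℝ, (∀ S, 0 ≤ coef S) ∧
          ∀ i, c i = ∑ S, coef S * (G S i : ℝ) := by
  intro k R F
  obtain ⟨G, hGker, hGsupp, hGne⟩ := cone_exists_gen F
  exact ⟨G, hGker, fun c hc hK => cone_exists_rep F G hGker hGsupp hGne c hc hK⟩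

end Summit.KontsevichZagierPeriods.LiouvilleUnfolding.LogPrimitiveNL
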